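import Literature.AnabelianGeometry.EtaleTheta.Discharge.Sec4RootLawThetaTwistTowerSubgroup
import Literature.AnabelianGeometry.EtaleTheta.Discharge.Sec5OfDenseQuotientTemperoid
import Literature.AnabelianGeometry.EtaleTheta.Discharge.Sec5JunctionSmallIndexHypotheses

/-!
# [EtTh] §4/§5 junction over the theta tower in the TRUE group-side shape: the §4 setting over `B^temp(closure(Im φ))⁰` for an
# ARBITRARY continuous `φ : Π^tp_X → Compat₃′`, with the Def. 3.6 (ii) tower model over that base (Def. 4.1 pp.312–313, §5 pp.322, 330 /
# PDF pp.86–87, 96, 104)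

S. Mochizuki, *The étale theta function …*, Publ. RIMS **45** (2009) [MochizukiEtTh2009], Def. 3.6 (ii) p.303 (PDF p.77), Def. 4.1 pp.312–313
(PDF pp.86–87), Prop. 4.2 (iii) p.315 (PDF p.89), §5 p.322 (PDF p.96), p.330 (PDF p.104); [FrdI] Thm. 5.2 p.100; [SemiAnbd] Def. 3.1 (i) p.33,
Rmk. 3.1.3 p.34.  [cite: MochizukiEtTh2009, Def 4.1 p.312–313 (PDF pp.86–87)]  PAGE CONVENTION for [EtTh]: «printed N (PDF p.M)», N = M + 226.

abc-iut cell, layer L2, seat abc-iut-L2-t3 (gen 10; [EtTh] §3/§4 lineage), row (β3) of the S2-repair of record of the §5 junction (abc-iut-L2-lead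
R1257 / R1277): the KNIT of (α) `mkOfClosureRange` (p504894), (β1) abc-iut-L2-t2's `LogDivisorTower.comap` (p505912/p506639), (β2-A)
`temperedFrobenioidSub` (p507623) and (β2-B) `baseRootLaw_galois_temperedFrobenioidSub` (p509205).  ONE def (`settingClosureRange`) + ONE
auxiliary def (`topOpenNormalSubgroup`); everything else theorems; ADDITIVE.
* **`settingClosureRange R S X φ NH M`** — for EVERY continuous `φ : Π^tp_X → Compat₃′` (`X : TemperedArithmeticGroup.{0} K`, `K : Type`): the §4
  bi-Kummer setting over `B^temp(closure(Im φ))⁰` whose tempered Frobenioid is the ε-free `(β)` theta tower RESTRICTED to the closed (⇒ tempered)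
  subgroup `closure(Im φ) ≤ Compat₃′`, small index `CosetCat`, `A_⊙ := (closure(Im φ)/M, 0)`.  THEOREMS, no hypothesis on `φ` beyond continuity:
  `_tf` (rfl), Def. 4.1 (ii) naturality + open kernels + `Ker φ ≤ H_⊙ = φ⁻¹(M)` (`settingClosureRange_laws`, from (α)), the [FrdI] Thm. 5.2
  hypotheses `h` of the §5 datum (`settingClosureRange_hypotheses`, (β2-A)), `Φ` perfect, `Φ^{bs-fld} ⊊ Φ`, the §5 binder `hH` for every `M ⊇ φ(ιX(Π^tp_Ÿ))`.
* **A10 `BaseRootLaw «Galois»` modulo the DISPLAYED level-exhaustion clause (LEV)** of (β2-B) (`settingClosureRange_baseRootLaw`): TRUE IN SHAPE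
  for the genuine `φ` (the Kummer class of `Θ̈` on `Δ_Θ` exhausts every level), vacuously false for level-poor images — recorded, not hidden.
* The socket **AT THE GENUINE `Π^tp_X̲̲` OF A `ThetaSetting`** (abc-iut-L2-t4's `X := C.temperedArithmeticGroup e`, abc-iut-L2-t8's
  `T := C.thetaEnvData μ hC hS`, `ιX := refl`): `hH_settingClosureRange_ofThetaSetting`, and the ENTRY theorem
  **`exists_biKummerSetting_ofThetaSetting_closureRange`: for EVERY continuous `φ : Π^tp_X̲̲ → Compat₃′` — NOTHING ELSE ASSUMED — a §4/§5 setting over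
  a multi-level tower model of Def. 3.6 (ii) EXISTS, with `Π^tp_Ÿ̲̲ ⊆ H_⊙`, Def. 4.1 (ii) naturality, open kernels, `Ker φ ≤ H_⊙`** (anchor `M := ⊤`;
  the canonical `Ÿ`-anchor `M := closure(φ(Π^tp_Ÿ))` is open under the level clause «`Ker(φ₃ ∘ φ) = Π^tp_Y`» — optional rider (O-Ÿ), not here).
WHAT THIS CLOSES (census S2 of `HOME/staging/L2/L2-t3/g10/JUNCTION-CENSUS-FourthModel-L2t3g10.md`): the junction's group-side hypothesis is now
«`φ` continuous» (the true shape) instead of the retired «`φ` onto `Compat₃′`» (false in shape for the genuine `φ`).  WHAT STAYS OPEN (honest): the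
CONSTRUCTION of the genuine `φ = ((κ_ϖ, κ_Ü, κ_Θ̈), χ, γ)` from compatible Kummer classes (§1/§2 lineages, L); (LEV) for its image; the theta function /
roots / constants data of the §5 datum (census D5/D7: abc-iut-L2-d2, abc-iut-L2-d3) — now to be read over THIS carrier.  HONEST LABEL: class-(b)
combinatorial DESIGN model (NOT the tempered Frobenioid of a Tate curve); nothing here bears on, or takes a side on, the disputed [IUTchIII] Cor. 3.12;
nothing here asserts abc proved or refuted; typed ≠ proved.
-/

noncomputable section

namespace Literature.AnabelianGeometry.EtaleTheta

open CategoryTheory Opposite Function Topology Literature.AlgebraicGeometry.Frobenioids Literature.AnabelianGeometry.SemiGraphs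
  Literature.AnabelianGeometry.SemiGraphs.GaloisObjects LogDivisorModel LogDivisorModel.GaloisAction LogDivisorTower
  TateTowerKummerTwistRShear LogDivisorModel.TateTowerThetaTwist

/-- The whole group as an open normal subgroup (the degenerate anchor `A_⊙ := (G/G, 0)`, used only to witness non-vacuity).
[cite: MochizukiEtTh2009, Def 4.1 p.312 (PDF p.86)] -/
def topOpenNormalSubgroup (G : Type*) [Group G] [TopologicalSpace G] : OpenNormalSubgroup G where
  toOpenSubgroup := ⊤
  isNormal' := by
    change (⊤ : Subgroup G).Normal
    infer_instance

/-- Everything lies in the top open normal subgroup. [cite: MochizukiEtTh2009, Def 4.1 p.312 (PDF p.86)] -/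
theorem mem_topOpenNormalSubgroup {G : Type*} [Group G] [TopologicalSpace G] (g : G) : g ∈ topOpenNormalSubgroup G := Subgroup.mem_top g

namespace ThetaTwistTowerSubgroup

section ClosureRange

variable {K : Type} [Field K] (X : TemperedArithmeticGroup.{0} K) (φ : X.Pi →ₜ* Compat 3 thetaShear)

/-- `closure(Im φ) ≤ Compat₃′` is tempered ([SemiAnbd] Def. 3.1 (i): closed subgroup of a tempered group; abc-iut-L1-t6's `isTemperedC`).
[cite: MochizukiSemiAnbd2006, Def 3.1 (i) p.33] -/
theorem isTempered_closureRange_compat₃ : IsTempered (closureRange φ) := isTempered_closureRange φ isTempered_compat₃'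

variable (R S : ((ConnectedPart (BTemp (closureRange φ)))ᵒᵖ ⥤ CommMonCat.{0}) → Prop)

/-- **The tempered Frobenioid of the junction in the true shape**: the ε-free `(β)` theta tower restricted to `closure(Im φ)`, small index
((β2-A) at `G := closureRange φ`). [cite: MochizukiEtTh2009, Def 3.6 p.303 (PDF p.77)] -/
abbrev tfClosureRange :
    TemperedFrobenioid
      (RealifiedDivisorMonoids.ofRlfZWeak (dmSubSmall (closureRange φ) (isTempered_closureRange_compat₃ X φ))
        (hpfSubSmall (closureRange φ) (isTempered_closureRange_compat₃ X φ)))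
      (ConnectedPart (BTemp (closureRange φ))) (treeCatVocab (ConnectedPart (BTemp (closureRange φ))) R S) :=
  temperedFrobenioidSub (closureRange φ) (isTempered_closureRange_compat₃ X φ) R S

variable (NH : Subgroup (Field.absoluteGaloisGroup K) → (tfClosureRange X φ R S).category → ℕ+ → Prop)
  (M : OpenNormalSubgroup (closureRange φ))

/-- **The §4 setting of the junction in the TRUE group-side shape**: for EVERY continuous `φ : Π^tp_X → Compat₃′`, the bi-Kummer setting over
`B^temp(closure(Im φ))⁰` with tempered Frobenioid the restricted theta tower and anchor `A_⊙ := (closure(Im φ)/M, 0)` ((α) `mkOfClosureRange`).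
[cite: MochizukiEtTh2009, Def 4.1 p.312–313 (PDF pp.86–87)] -/
def settingClosureRange :
    BiKummerSetting X
      (RealifiedDivisorMonoids.ofRlfZWeak (dmSubSmall (closureRange φ) (isTempered_closureRange_compat₃ X φ))
        (hpfSubSmall (closureRange φ) (isTempered_closureRange_compat₃ X φ)))
      (ConnectedPart (BTemp (closureRange φ))) (treeCatVocab (ConnectedPart (BTemp (closureRange φ))) R S) :=
  BiKummerSetting.mkOfClosureRange X isTempered_compat₃' φ (tfClosureRange X φ R S) rfl
    (hPSub (closureRange φ) (isTempered_closureRange_compat₃ X φ) R S) NH M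

/-- Its tempered Frobenioid is the restricted theta tower (definitionally). [cite: MochizukiEtTh2009, Def 4.1 p.312 (PDF p.86)] -/
theorem settingClosureRange_tf : (settingClosureRange X φ R S NH M).tf = tfClosureRange X φ R S := rfl

/-- **Def. 4.1 (ii) naturality, open kernels and `Ker φ ≤ H_⊙` — THEOREMS for every continuous `φ`** ((α) `mkOfClosureRange_laws`).
[cite: MochizukiEtTh2009, Def 4.1 (ii) p.313 (PDF p.87)] -/
theorem settingClosureRange_laws :
    (settingClosureRange X φ R S NH M).GaloisSurjNatural ∧ (settingClosureRange X φ R S NH M).IsOpenKerGaloisSurj ∧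
      φ.toMonoidHom.ker ≤ (settingClosureRange X φ R S NH M).Hodot :=
  BiKummerSetting.mkOfClosureRange_laws X isTempered_compat₃' φ (tfClosureRange X φ R S) rfl _ NH M

/-- **`H_⊙ = φ⁻¹(M)`** (membership, read in `Compat₃′`). [cite: MochizukiEtTh2009, Def 4.1 p.312 (PDF p.86)] -/
theorem mem_Hodot_settingClosureRange_iff (g : X.Pi) :
    g ∈ (settingClosureRange X φ R S NH M).Hodot ↔ (⟨φ g, apply_mem_closureRange φ g⟩ : closureRange φ) ∈ M :=
  BiKummerSetting.mem_Hodot_mkOfClosureRange_iff X isTempered_compat₃' φ (tfClosureRange X φ R S) rfl _ NH M g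

/-- **The [FrdI] Thm. 5.2 hypotheses `h` of the §5 datum HOLD for the setting's tempered Frobenioid** ((β2-A)), no hypothesis.
[cite: MochizukiFrdI2008, Thm. 5.2 p.100] -/
theorem settingClosureRange_hypotheses :
    ModelFrobenioid.Hypotheses (settingClosureRange X φ R S NH M).tf.divisorMonoid (settingClosureRange X φ R S NH M).tf.ratFnFunctor :=
  hypotheses_temperedFrobenioidSub (closureRange φ) _ R S

/-- `Φ` is perfect at every covering (the `hP` slot). [cite: MochizukiEtTh2009, Def 4.1 p.312 (PDF p.86)] -/
theorem settingClosureRange_hP (A : (ConnectedPart (BTemp (closureRange φ)))ᵒᵖ) :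
    IsPerfect ((settingClosureRange X φ R S NH M).tf.Φ.carrier A) :=
  hPSub (closureRange φ) _ R S A

/-- `Φ^{bs-fld} ⊊ Φ` at every covering of the setting's base (the class of `Θ̈`'s zeros). [cite: MochizukiEtTh2009, Def 3.6 p.303 (PDF p.77)] -/
theorem settingClosureRange_exists_mem_Φ_not_mem_bsFld (A : ConnectedPart (BTemp (closureRange φ))) :
    ∃ x ∈ (settingClosureRange X φ R S NH M).tf.Φ.carrier (op A), x ∉ (settingClosureRange X φ R S NH M).tf.bsFld.carrier (op A) :=
  exists_mem_Φ_not_mem_bsFld_sub (closureRange φ) _ R S A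

/-- **A10 `BaseRootLaw «Galois»` for the setting — modulo the DISPLAYED level-exhaustion clause (LEV) on `closure(Im φ)`** ((β2-B)).
[cite: MochizukiEtTh2009, Prop 4.2 (iii) p.315 (PDF p.89)] -/
theorem settingClosureRange_baseRootLaw
    (hlev : ∀ n m : ℕ, (∀ g : closureRange φ, (g : Compat 3 thetaShear) ∈ closureC 3 thetaShear n →
      (g : Compat 3 thetaShear) ∈ kumLevelC₃ m) → m ≤ n) :
    (settingClosureRange X φ R S NH M).tf.BaseRootLaw (settingClosureRange X φ R S NH M).IsGaloisObj :=
  baseRootLaw_galois_temperedFrobenioidSub (closureRange φ) _ R S hlev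

/-- **The §5 binder `hH` (`Π^tp_Ÿ ⊆ H_⊙`) whenever `φ(ιX(Π^tp_Ÿ)) ⊆ M`.** [cite: MochizukiEtTh2009, §5 p.330 (PDF p.104)] -/
theorem hH_settingClosureRange_of_forall_mem {P : Type*} [Group P] [TopologicalSpace P] (ιX : P ≃ₜ* X.Pi) (PiYdd : Subgroup P)
    (hM : ∀ y : P, y ∈ PiYdd → (⟨φ (ιX y), apply_mem_closureRange φ (ιX y)⟩ : closureRange φ) ∈ M) :
    ∀ y : P, y ∈ PiYdd → ιX y ∈ (settingClosureRange X φ R S NH M).Hodot :=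
  BiKummerSetting.hH_mkOfClosureRange_of_forall_mem X isTempered_compat₃' φ (tfClosureRange X φ R S) rfl _ NH M ιX PiYdd hM

/-- With the degenerate anchor `M := ⊤` the §5 binder `hH` holds for EVERY subgroup. [cite: MochizukiEtTh2009, §5 p.330 (PDF p.104)] -/
theorem hH_settingClosureRange_top {P : Type*} [Group P] [TopologicalSpace P] (ιX : P ≃ₜ* X.Pi) (PiYdd : Subgroup P) :
    ∀ y : P, y ∈ PiYdd → ιX y ∈ (settingClosureRange X φ R S NH (topOpenNormalSubgroup _)).Hodot :=
  hH_settingClosureRange_of_forall_mem X φ R S NH _ ιX PiYdd fun _ _ => mem_topOpenNormalSubgroup _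

end ClosureRange

/-! ## The socket AT THE GENUINE `Π^tp_X̲̲` of a `ThetaSetting` — true shape -/

section OfThetaSetting

variable {p : ℕ} [Fact p.Prime] {D : ThetaSetting p} {E : D.EtaleThetaData} {l : ℕ} (C : E.DoubleUnderline l)
  (e : D.toTemperedCurve.GroupLevelData) {N : ℕ+} (μ : D.CyclotomeMod l N) (hC : D.Compat) (hS : D.Sec2Hyps)
  (φ : (C.temperedArithmeticGroup e).Pi →ₜ* Compat 3 thetaShear)
  (R S : ((ConnectedPart (BTemp (closureRange φ)))ᵒᵖ ⥤ CommMonCat.{0}) → Prop)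
  (NH : Subgroup (Field.absoluteGaloisGroup D.K) → (tfClosureRange (C.temperedArithmeticGroup e) φ R S).category → ℕ+ → Prop)
  (M : OpenNormalSubgroup (closureRange φ))

/-- **`Π^tp_Ÿ̲̲ ⊆ H_⊙` at the genuine groups** for every anchor `M ⊇ φ(Π^tp_Ÿ̲̲)` (the §5 binder `hH` for the Setting's `Π^tp_Ÿ̲̲`, `ιX := refl`).
[cite: MochizukiEtTh2009, §5 p.330 (PDF p.104)] -/
theorem hH_settingClosureRange_ofThetaSetting
    (hM : ∀ y : (C.thetaEnvData μ hC hS).PiX, y ∈ (C.thetaEnvData μ hC hS).PiYdd → (⟨φ y, apply_mem_closureRange φ y⟩ : closureRange φ) ∈ M) :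
    ∀ y : (C.thetaEnvData μ hC hS).PiX, y ∈ (C.thetaEnvData μ hC hS).PiYdd →
      y ∈ (settingClosureRange (C.temperedArithmeticGroup e) φ R S NH M).Hodot :=
  hH_settingClosureRange_of_forall_mem (C.temperedArithmeticGroup e) φ R S NH M (ContinuousMulEquiv.refl _) (C.thetaEnvData μ hC hS).PiYdd hM

include μ hC hS R S in
/-- **ENTRY THEOREM — the junction carrier in the TRUE group-side shape is INHABITED at the genuine tempered fundamental group**: for EVERY
continuous homomorphism `φ : Π^tp_X̲̲ → Compat₃′` of the `Π^tp_X̲̲` of a `ThetaSetting` — NO surjectivity, NO density, nothing else — there is a §4/§5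
bi-Kummer setting over the multi-level tower model of Def. 3.6 (ii) over `B^temp(closure(Im φ))⁰` with `Π^tp_Ÿ̲̲ ⊆ H_⊙`, Def. 4.1 (ii) naturality,
open kernels and `Ker φ ≤ H_⊙`. [cite: MochizukiEtTh2009, Def 4.1 p.312–313 (PDF pp.86–87); §5 p.330 (PDF p.104)] -/
theorem exists_biKummerSetting_ofThetaSetting_closureRange :
    ∃ 𝔖 : BiKummerSetting (C.temperedArithmeticGroup e)
        (RealifiedDivisorMonoids.ofRlfZWeak
          (dmSubSmall (closureRange φ) (isTempered_closureRange_compat₃ (C.temperedArithmeticGroup e) φ))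
          (hpfSubSmall (closureRange φ) (isTempered_closureRange_compat₃ (C.temperedArithmeticGroup e) φ)))
        (ConnectedPart (BTemp (closureRange φ))) (treeCatVocab (ConnectedPart (BTemp (closureRange φ))) R S),
      𝔖.tf = tfClosureRange (C.temperedArithmeticGroup e) φ R S ∧
      (∀ y : (C.thetaEnvData μ hC hS).PiX, y ∈ (C.thetaEnvData μ hC hS).PiYdd → y ∈ 𝔖.Hodot) ∧
      𝔖.GaloisSurjNatural ∧ 𝔖.IsOpenKerGaloisSurj ∧ φ.toMonoidHom.ker ≤ 𝔖.Hodot :=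
  ⟨settingClosureRange (C.temperedArithmeticGroup e) φ R S (fun _ _ _ => True) (topOpenNormalSubgroup _), rfl,
    hH_settingClosureRange_top (C.temperedArithmeticGroup e) φ R S _ (ContinuousMulEquiv.refl _) (C.thetaEnvData μ hC hS).PiYdd,
    settingClosureRange_laws (C.temperedArithmeticGroup e) φ R S _ _⟩

include NH M in
/-- **… and with A10 `BaseRootLaw «Galois»` under the displayed clause (LEV) on the image.** [cite: MochizukiEtTh2009, Prop 4.2 (iii) p.315 (PDF p.89)] -/
theorem exists_biKummerSetting_ofThetaSetting_closureRange_baseRootLaw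
    (hlev : ∀ n m : ℕ, (∀ g : closureRange φ, (g : Compat 3 thetaShear) ∈ closureC 3 thetaShear n →
      (g : Compat 3 thetaShear) ∈ kumLevelC₃ m) → m ≤ n) :
    ∃ 𝔖 : BiKummerSetting (C.temperedArithmeticGroup e)
        (RealifiedDivisorMonoids.ofRlfZWeak
          (dmSubSmall (closureRange φ) (isTempered_closureRange_compat₃ (C.temperedArithmeticGroup e) φ))
          (hpfSubSmall (closureRange φ) (isTempered_closureRange_compat₃ (C.temperedArithmeticGroup e) φ)))
        (ConnectedPart (BTemp (closureRange φ))) (treeCatVocab (ConnectedPart (BTemp (closureRange φ))) R S),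
      𝔖.tf = tfClosureRange (C.temperedArithmeticGroup e) φ R S ∧ 𝔖.GaloisSurjNatural ∧ 𝔖.IsOpenKerGaloisSurj ∧
        𝔖.tf.BaseRootLaw 𝔖.IsGaloisObj :=
  ⟨settingClosureRange (C.temperedArithmeticGroup e) φ R S NH M, rfl,
    (settingClosureRange_laws (C.temperedArithmeticGroup e) φ R S NH M).1,
    (settingClosureRange_laws (C.temperedArithmeticGroup e) φ R S NH M).2.1,
    settingClosureRange_baseRootLaw (C.temperedArithmeticGroup e) φ R S NH M hlev⟩

end OfThetaSetting

end ThetaTwistTowerSubgroup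

end Literature.AnabelianGeometry.EtaleTheta

end
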